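import Summits.NavierStokesRegularity.NavierStokesRegularity.Theorems.ExtremiserTransienceNearExtremalTransiencePerFlowOfFilamentSelectionAllTime
import Summits.NavierStokesRegularity.NavierStokesRegularity.Theorems.ExtremiserTransienceNearExtremalTransiencePerFlowMemberSelectionZoomInvariance
import Summits.NavierStokesRegularity.NavierStokesRegularity.Theorems.ExtremiserTransiencePerFlowScaleLockOfEnstrophyRate
import Summits.NavierStokesRegularity.NavierStokesRegularity.Theorems.ExtremiserTransienceKStarAttainedDensity
import Summits.NavierStokesRegularity.NavierStokesRegularity.Theorems.ExtremiserTransienceFilamentGapSliceTools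
import Summits.NavierStokesRegularity.NavierStokesRegularity.Theses.TypeIQuarterGate
import HarnessLib

/-!
# LINE g11-α «Leray pincer» — crux `NearExtremalTransiencePerFlow` (stmt-NavierStokesRegularity-26567), route `ExtremiserTransience`

Ideator seat `ns-idea-5`, generation g11 (technique card «extremal-example mining»).  FILES-ONLY crux workfile (D-0145; no route is
opened, nothing is registered by this file).  Rev 3 adds §5: the GAP form `BoundedBudgetGap` of T (typed mined
conjecture, not registered) with the proved implication `tightOfBoundedBudget_of_gap : BoundedBudgetGap → TightOfBoundedBudget`;  HONEST FRAMING: no summit is proved by a line; this skeleton proves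
`stub_tightOfBoundedBudget → stub_lerayRateOnEfficientTimes → NearExtremalTransiencePerFlow` and nothing about Navier–Stokes beyond the
tree theorems it invokes.

## Why this line (the lever in five words: «bounded budget forces extremal limit»)

Every line of record on this crux (g7-δ member selection, g8 T1/Z1*, g9 filament gap/selection, g10-α/β/γ chain · tight-or-chain ·
multiscale crowding) fights the SAME enemy: an unbounded CROWD of vortex cells in the blow-up zoom (`N → ∞` cells of enstrophy, the
«necklace»), and g10-γ's METHOD-CEILING analysis shows the backward energy LEDGER cannot go below its heart T♭.  Extremal-example mining
(g7/g8 instrument rows FIXED-B/C′, CROWD-OPEN j312749, DILUTE-GAP j327037/j327350) says WHY crowds are the enemy: efficiency is bought by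
crowding, and no BOUNDED configuration was ever seen to beat a larger crowd.  This line turns that observation into mathematics from the
opposite end:

* STATIC stub T `TightOfBoundedBudget` (NEW, provable, size L): a near-extremal family whose enstrophy budgets `Z(v n) = ∫ ‖curl v n‖²`
  stay bounded along a subsequence has a translate-subsequence converging to an EXACT extremiser of the sharp inequality
  (`IsExtremalSlice`).  Mechanism (Lions concentration-compactness for the scale-free functional `J/(M √Z √P)`, made quantitative by
  three tree facts): (i) Biot–Savart + linear growth: an `η`-strong point (`‖v‖ ≥ η := κ⋆/4`) needs local enstrophy `≥ c(η, Z̄, Λ₁)`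
  within distance `D₀ = 16π Z̄/η²`, so the strong set is covered by `≤ N₀ = Z̄/c` balls — a BOUNDED crowd; (ii) the «sea identity»
  `∫ ζ ω·Sω = −∫ ζ v·(ω·∇)ω − ∫ (∇ζ·ω)(v·ω)` (from `div ω = 0`) prices the complement of the crowd at efficiency `≤ η < κ⋆` plus
  `O(Z̄ N₀/R)`; (iii) the extended sharp inequality `extendedSharp` on each `C^∞_loc` cluster limit and ONE Cauchy–Schwarz step
  `Σ√(ZᵢPᵢ) + √(Z_sea P_sea) ≤ √(Z P)` force zero budget loss and one cluster limit to be exactly extremal at height `1`.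
  No gauge, no dissipation ledger, no Liouville theorem is used: bounded budget REPLACES tightness.
* FLOW stub Q♭ `LerayRateOnEfficientTimes` (the heart; a DYNAMIC input that is NOT the backward energy ledger): along the near-efficient
  no-dust late times of a Type-I violator the enstrophy saturates LERAY's quarter rate infinitely often, `Z(tₙ) √(T − tₙ) ≤ K`.  Under
  the NS zoom `V n = Mb⁻¹ • u(tₙ)((ν/Mb) • ·)` this is EXACTLY boundedness of `Z(V n)` (`enstrophy_zoom` + Leray's lower rate
  `c₀ √ν ≤ √(T − t) Mb`, both tree theorems), so T applies, the limit is an extremal slice of a Type-I ancient mild solution, and the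
  landed `not_isExtremalSlice_of_typeIAncientMild` (E∞ + R7) closes the violator frame.  Q♭ is implied BY NAME-SHAPE by the ladder
  rung `TypeIQuarterGate.QuarterLawTypeI` (stmt-NavierStokesRegularity-23726; `IsMaximalSmoothSolution = classical ∧ ¬extension` is
  definitional, `IsTypeIBlowup` is the eventual rate, `lintegral → integral`) and hence by `EfficiencyFloor.EnstrophyQuarterLaw`
  (stmt-1574, the residual shared by seven K-a routes): §2b proves `quarterLawOnViolators_of_quarterLawTypeI` (23726 VERBATIM ⇒
  the violator-form quarter law) and `lerayRateOnEfficientTimes_of_quarterLawTypeI` (23726 ⇒ Q♭), and §4 ends with the kernel-checked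
  WELD `NearExtremalTransiencePerFlow_of_quarterLawTypeI : stub_tightOfBoundedBudget → QuarterLawTypeI → NearExtremalTransiencePerFlow`.
  So this line WELDS crux 26567 to the quarter-law ladder: 26567 ⇐ T ∧ Q♭, Q♭ ⇐ 23726 ⇐ 1574 — all arrows but T and 23726 theorems.

bears_on: LADDER-NS rung of record for 26567 (K-a, ExtremiserTransience) AND TypeIQuarterGate/QuarterLawTypeI (23726) — the first
kernel object joining the two ladders.  Residual enemy after this line (named, not hidden): a Type-I violator whose near-efficient times
all carry SUPER-Leray enstrophy `Z(t)√(T−t) → ∞` — by T's cluster count this is precisely «unbounded cell multiplication», the regime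
g10-γ's T♭ attacks from the static side; the two lines are complementary, not rivals.

## Why novel vs the listed routes/lines
Nearest: g10-β `TightOrChain` / g10-γ `TightOrCrowding` (tightness dichotomies whose non-tight branch is killed by the ENERGY LEDGER
L1–L3).  Delta: here tightness is DERIVED from a budget bound (new static theorem T, no dichotomy branch), and the flow input is the
Leray-rate saturation Q♭ (quarter-law family: TypeIQuarterGate, EfficiencyFloor, LerayQuarterDissipation attack it per se; none of them
feeds 26567).  Not H′/Z-row (no tube test), not T1 (no gauge: checklist 4c(i) moot), not the DSS/KStarAttained finite routes.

## Cheapest falsifier · instrument row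
Falsifier of T: a bounded-budget near-extremal family with NO extremal translate-limit — impossible by the proof sketch unless the
Biot–Savart cluster count fails, i.e. unless strong points can live on arbitrarily little local enstrophy (contradicts `cellNumber_lower`).
Falsifier of Q♭: a Type-I violator needs none; the INSTRUMENT is row «BUDGET-LADDER» (to be minted by the director if wanted): in the g8
FIXED-B′/CROWD-OPEN engines, record max efficiency `e(N)` against total budget `Z` at fixed height/gradient normalisation; T predicts
`sup_{Z ≤ B} e < κ⋆` strictly for every `B` iff `KStarAttained` fails, and Q♭ predicts the violator lives at bounded `B` infinitely often.

## C0 / probes (planner's record; see the line card `leray_pincer.md`)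
R 4 (T, Q♭ each strictly weaker than the crux: T is static, Q♭ is implied by 23726 which does not imply NS regularity) · A 4 (first
lemma of T typed below as `StrongPointBudget`) · L 4 · B 3 (scaling/gauge barriers do not quantify over Q♭; Q♭ sits INSIDE the
quarter-law wall, priced) · K 4.  BC2: `Q♭ → crux`, `T → crux`, `Q♭ → NavierStokesRegularity` do not close by `exact?|simpa|aesop`
(probe file `bc/leray_pincer_probe.lean`, rc≠0 as required); BC7 `#h21_crux_probe` verdicts recorded in the card.
-/

noncomputable section

open scoped Topology InnerProductSpace RealInnerProductSpace ENNReal ContDiff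
open MeasureTheory Filter Set Metric Function
open Literature.Analysis Literature.Analysis.FluidPDE
open Summit.NavierStokesRegularity.NavierStokesRegularity.Theses.ExtremiserTransience
open Summit.NavierStokesRegularity.NavierStokesRegularity.Theorems
open Summit.NavierStokesRegularity.NavierStokesRegularity.Theorems.DepletionLadder.KStar.HalfSpace
open Summit.NavierStokesRegularity.NavierStokesRegularity.Theorems.NearExtremalTransiencePerFlow.ZoneTransversality
open Summit.NavierStokesRegularity.NavierStokesRegularity.Theorems.NearExtremalTransiencePerFlow.MemberSelection
open Summit.NavierStokesRegularity.NavierStokesRegularity.Theorems.NearExtremalTransiencePerFlow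

namespace Summit.NavierStokesRegularity.NavierStokesRegularity.Cruxes.NearExtremalTransiencePerFlow.LerayPincer

set_option linter.dupNamespace false

/-! ## §1 The two stub statements -/

/-- **STUB T — «bounded budget forces an extremal limit»** (static, NEW; size L).  A near-extremal height-`1` family
(`NearExtremalFamily`: smooth, divergence-free, `‖v n‖ ≤ 1`, all derivatives uniformly bounded, finite `Ḣ¹, Ḣ²` budgets, efficiency
deficit `ε n → 0`, Taylor bound) with eventual linear local-energy growth whose ENSTROPHY BUDGETS are bounded along a subsequence has
centres `y`, a subsequence `φ` and a pointwise translate-limit `W₀` that is an exact extremiser of the sharp depletion inequality.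
Why it might fail: only if an `η`-strong point could carry arbitrarily little enstrophy within bounded distance (it cannot: Biot–Savart,
`cellNumber_lower`), or if budget could leak to infinity at efficiency `≥ κ⋆` (the sea identity prices leaks at `≤ κ⋆/4`). -/
def TightOfBoundedBudget : Prop :=
  ∀ (v : ℕ → E3 → E3) (Λ : ℕ → ℝ) (Θ : ℝ) (ε : ℕ → ℝ) (A Zb : ℝ),
    NearExtremalFamily v Λ Θ ε →
    (∀ᶠ n in atTop, ∀ (x : E3) (R : ℝ), 0 < R → ∫ z in Metric.ball x R, ‖v n z‖ ^ 2 ≤ A * R) →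
    (∃ᶠ n in atTop, ∫ x, ‖curl (v n) x‖ ^ 2 ≤ Zb) →
    ∃ (y : ℕ → E3) (φ : ℕ → ℕ) (W₀ : E3 → E3), StrictMono φ ∧
      (∀ z : E3, Tendsto (fun n => v (φ n) (y (φ n) + z)) atTop (𝓝 (W₀ z))) ∧ IsExtremalSlice W₀

/-- **STUB Q♭ — «Leray-rate saturation on the efficient times»** (flow HEART; open, strictly below `QuarterLawTypeI`).  For a Type-I
violator (`IsViolator`: classical Leray–Hopf flow with rapidly decaying data, eventual rate `√(T−t)‖u‖ ≤ C√ν`, first singular time `T`,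
failing the per-flow conclusion) and ANY near-efficient no-dust data (`EfficientTimesData`, produced by the landed T0
`efficientTimesNoDust_holds`), the enstrophy saturates Leray's lower rate `Z ≳ ν^{3/2}/√(T−t)` infinitely often along the data:
`Z(tₙ)·√(T − tₙ) ≤ K`.  Why it might fail: a violator whose vortex cells MULTIPLY without bound at every near-efficient time
(`Z(t)√(T−t) → ∞`, the g4 KEY-RISK scenario `N ≲ (T−t)^{1/2−κ⋆²C²/2}`); sources: Leray 1934 §34; TypeIQuarterGate (23726);
EfficiencyFloor.EnstrophyQuarterLaw (1574); arXiv:1802.09936 (Protas–Ayala maximal enstrophy growth). -/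
def LerayRateOnEfficientTimes : Prop :=
  ∀ (C ν T : ℝ) (u : ℝ → E3 → E3) (p : ℝ → E3 → ℝ), IsViolator C ν T u p →
    ∀ (Θ : ℝ) (t Mb ε : ℕ → ℝ), EfficientTimesData ν T u Θ t Mb ε →
      ∃ K : ℝ, ∃ᶠ n in atTop, (∫ x, ‖curl (u (t n)) x‖ ^ 2) * Real.sqrt (T - t n) ≤ K

/-- The QUARTER LAW in violator form (the shape of `TypeIQuarterGate.QuarterLawTypeI`, stmt-NavierStokesRegularity-23726, with
`IsMaximalSmoothSolution` unfolded to `classical ∧ ¬extension`, `IsTypeIBlowup` specialised to the violator's eventual rate and the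
enstrophy written as a Bochner integral): `Z(t) √(T−t) ≤ K` on all of `[0, T)`.  Not a stub of this line — recorded to show where Q♭
sits on the ladder (`lerayRateOnEfficientTimes_of_quarterLaw`). -/
def QuarterLawOnViolators : Prop :=
  ∀ (C ν T : ℝ) (u : ℝ → E3 → E3) (p : ℝ → E3 → ℝ), IsViolator C ν T u p →
    ∃ K : ℝ, ∀ t ∈ Set.Ico 0 T, (∫ x, ‖curl (u t) x‖ ^ 2) * Real.sqrt (T - t) ≤ K

/-- The first lemma of stub T, typed (Attack axis of C0; NOT registered, not used by the skeleton): an `η`-strong point of a bounded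
divergence-free field with square-integrable vorticity and linear local-energy growth carries local enstrophy `≥ c` within a bounded
distance `D`, with `c, D` depending only on `η`, the budget bound, the gradient bound and the growth constant.  (Biot–Savart far/near
split; cf. the landed `cellNumber_lower`.) -/
def StrongPointBudget : Prop :=
  ∀ (η Zb B A : ℝ), 0 < η → 0 < Zb → 0 < B → 0 < A →
    ∃ (c D : ℝ), 0 < c ∧ 0 < D ∧
      ∀ (v : E3 → E3), ContDiff ℝ (⊤ : ℕ∞) v → VectorCalculus.IsDivFree v → (∀ x, ‖v x‖ ≤ 1) →
        (∀ x, ‖fderiv ℝ v x‖ ≤ B) → (∫ x, ‖curl v x‖ ^ 2 ≤ Zb) → (∫⁻ x, ‖iteratedFDeriv ℝ 1 v x‖ₑ ^ 2 < ⊤) →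
        (∀ (x : E3) (R : ℝ), 0 < R → ∫ z in Metric.ball x R, ‖v z‖ ^ 2 ≤ A * R) →
        ∀ x₀ : E3, η ≤ ‖v x₀‖ → c ≤ ∫ z in Metric.ball x₀ D, ‖curl v z‖ ^ 2

/-! ## §2 Glue proved in this file -/

/-- Near-efficient no-dust data restrict to near-efficient no-dust data along any strictly increasing reindexing. -/
theorem efficientTimesData_subseq {ν T : ℝ} {u : ℝ → E3 → E3} {Θ : ℝ} {t Mb ε : ℕ → ℝ}
    (h : EfficientTimesData ν T u Θ t Mb ε) {ρ : ℕ → ℕ} (hρ : StrictMono ρ) :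
    EfficientTimesData ν T u Θ (fun n => t (ρ n)) (fun n => Mb (ρ n)) (fun n => ε (ρ n)) := by
  obtain ⟨h1, h2, h3, h4, h5, h6, h7, h8⟩ := h
  exact ⟨fun n => h1 _, h2.comp hρ.tendsto_atTop, h3.comp hρ.tendsto_atTop, fun n => h4 _, fun n x => h5 _ x,
    fun n => h6 _, fun n => h7 _, fun n => h8 _⟩

/-- Where Q♭ sits: the violator-form quarter law (all times) trivially gives Leray-rate saturation along every data sequence. -/
theorem lerayRateOnEfficientTimes_of_quarterLaw (hQ : QuarterLawOnViolators) : LerayRateOnEfficientTimes := by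
  intro C ν T u p hV Θ t Mb ε hD
  obtain ⟨K, hK⟩ := hQ C ν T u p hV
  exact ⟨K, Eventually.frequently (Eventually.of_forall fun n => hK (t n) (hD.1 n))⟩

/-! ## §2b LADDER WELD (kernel-checked): rung `TypeIQuarterGate.QuarterLawTypeI` (stmt-NavierStokesRegularity-23726, VERBATIM) ⇒
`QuarterLawOnViolators` ⇒ Q♭.  (`IsMaximalSmoothSolution = classical ∧ ¬extension` is definitional; the violator's eventual rate
`√(T−t)‖u‖ ≤ C√ν` is `IsTypeIBlowup` with constant `C√ν`; the `lintegral` enstrophy bound is converted to the Bochner integral.) -/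

/-- 23726 ⇒ the violator-form quarter law. -/
theorem quarterLawOnViolators_of_quarterLawTypeI (hQ : Theses.TypeIQuarterGate.QuarterLawTypeI) : QuarterLawOnViolators := by
  intro C ν T u p hV
  obtain ⟨hC, hν, hT, hsol, hLH, hdec, hrate, hext, -⟩ := hV
  have hmax : IsMaximalSmoothSolution ν 0 u p T := ⟨hsol, hext⟩
  have hTI : IsTypeIBlowup u T := by
    refine ⟨C * Real.sqrt ν, ?_⟩
    have hlt : ∀ᶠ t in 𝓝[<] T, t < T := self_mem_nhdsWithin
    filter_upwards [hrate, hlt] with t ht htT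
    intro x
    have hpos : 0 < Real.sqrt (T - t) := Real.sqrt_pos.2 (sub_pos.2 htT)
    rw [le_div_iff₀ hpos, mul_comm]
    exact ht x
  obtain ⟨K, hK⟩ := hQ ν T hν hT u p hmax hLH hdec hTI
  refine ⟨max K 0, fun t ht => ?_⟩
  have hpos : 0 < Real.sqrt (T - t) := Real.sqrt_pos.2 (sub_pos.2 ht.2)
  have hlin := hK t ht
  have hcont : Continuous (curl (u t)) := (DepletionLadder.KStar.contDiff_curl_top (hsol.contDiff_velocity ht)).continuous
  have hmeas : AEStronglyMeasurable (fun x => ‖curl (u t) x‖ ^ 2) volume := (hcont.norm.pow 2).aestronglyMeasurable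
  rw [integral_eq_lintegral_of_nonneg_ae (Eventually.of_forall fun x => sq_nonneg _) hmeas]
  have h3 : ∫⁻ x, ENNReal.ofReal (‖curl (u t) x‖ ^ 2) = ∫⁻ x, ‖curl (u t) x‖ₑ ^ 2 :=
    lintegral_congr fun x => FilamentGap.ofReal_norm_sq_eq_enorm_sq _
  rw [h3]
  have h4 : (∫⁻ x, ‖curl (u t) x‖ₑ ^ 2).toReal ≤ max (K / Real.sqrt (T - t)) 0 := by
    have h := ENNReal.toReal_mono ENNReal.ofReal_ne_top hlin
    rwa [ENNReal.toReal_ofReal'] at h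
  calc (∫⁻ x, ‖curl (u t) x‖ₑ ^ 2).toReal * Real.sqrt (T - t) ≤ max (K / Real.sqrt (T - t)) 0 * Real.sqrt (T - t) := by
        gcongr
    _ ≤ max K 0 := by
        rcases le_or_gt 0 K with hK0 | hK0
        · rw [max_eq_left (div_nonneg hK0 hpos.le), div_mul_cancel₀ _ hpos.ne', max_eq_left hK0]
        · rw [max_eq_right (div_neg_of_neg_of_pos hK0 hpos).le, zero_mul]
          exact le_max_right _ _

/-- 23726 ⇒ Q♭: the flow heart of this line is BELOW the quarter-law rung of the ladder (kernel-checked weld). -/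
theorem lerayRateOnEfficientTimes_of_quarterLawTypeI (hQ : Theses.TypeIQuarterGate.QuarterLawTypeI) :
    LerayRateOnEfficientTimes :=
  lerayRateOnEfficientTimes_of_quarterLaw (quarterLawOnViolators_of_quarterLawTypeI hQ)

/-! ## §3 The two registered-style stubs and their registration names -/

/-- STUB T (static, L). -/
theorem stub_tightOfBoundedBudget : TightOfBoundedBudget := by
  sorry

/-- STUB Q♭ (flow heart). -/
theorem stub_lerayRateOnEfficientTimes : LerayRateOnEfficientTimes := by
  sorry

namespace Registered

/-- = `TightOfBoundedBudget`. -/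
abbrev stub_tightOfBoundedBudget : Prop := TightOfBoundedBudget
/-- = `LerayRateOnEfficientTimes`. -/
abbrev stub_lerayRateOnEfficientTimes : Prop := LerayRateOnEfficientTimes

end Registered

/-! ## §4 THE SKELETON: T + Q♭ ⇒ the crux BY NAME (no `sorry` outside the two stubs) -/

/-- **LINE g11-α SKELETON.**  Violator frame by contradiction → F1 growth budget `A` (`flowFilamentBudget`) → T0 data
(`efficientTimesNoDust_holds`) → Q♭: a saturating subsequence `ρ` (`extraction_of_frequently_atTop`) → sub-data
(`efficientTimesData_subseq`) → T2′ zoom family + flow compactness (`zoomPackageFlow`) → member growth (`ballEnergy_zoom_le`) and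
BOUNDED member budgets (`enstrophy_zoom` + Leray's lower rate `lerayLowerRate_of_not_extends` + saturation) → T: centres, subsequence,
EXTREMAL limit `W₀` → flow compactness at those centres: `W₀ = W s` with `W` Type-I ancient mild, `s < 0` →
`not_isExtremalSlice_of_typeIAncientMild`. -/
theorem NearExtremalTransiencePerFlow_of
    (hT : Registered.stub_tightOfBoundedBudget) (hQ : Registered.stub_lerayRateOnEfficientTimes) :
    NearExtremalTransiencePerFlow := by
  have hT0 : EfficientTimesNoDust := efficientTimesNoDust_holds
  intro C ν T hC hν hT' u p hsol hLH hdec hrate hsing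
  by_contra hno
  have hV : IsViolator C ν T u p := ⟨hC, hν, hT', hsol, hLH, hdec, hrate, hsing, hno⟩
  obtain ⟨A, hA⟩ := FilamentGap.flowFilamentBudget C ν T hC hν hT' u p hsol hLH hdec hrate
  obtain ⟨Θ, t₀, Mb₀, ε₀, hdata₀⟩ := hT0 C ν T u p hV
  -- Q♭ on T0's data: a saturating subsequence `ρ`
  obtain ⟨K, hfreq⟩ := hQ C ν T u p hV Θ t₀ Mb₀ ε₀ hdata₀
  obtain ⟨ρ, hρ, hρK⟩ := extraction_of_frequently_atTop hfreq
  have hdata : EfficientTimesData ν T u Θ (fun n => t₀ (ρ n)) (fun n => Mb₀ (ρ n)) (fun n => ε₀ (ρ n)) :=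
    efficientTimesData_subseq hdata₀ hρ
  -- T2′ on the sub-data
  obtain ⟨σ, Λ, Θ', ε', hσ, hfam, hcompF⟩ :=
    FilamentSelection.zoomPackageFlow C ν T u p hV Θ (fun n => t₀ (ρ n)) (fun n => Mb₀ (ρ n)) (fun n => ε₀ (ρ n)) hdata
  set t : ℕ → ℝ := fun n => t₀ (ρ n) with ht_def
  set Mb : ℕ → ℝ := fun n => Mb₀ (ρ n) with hMb_def
  set V : ℕ → E3 → E3 := fun n z => (Mb (σ n))⁻¹ • u (t (σ n)) ((ν / Mb (σ n)) • z) with hVdef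
  have hfamV : NearExtremalFamily V Λ Θ' ε' := hfam
  have htT : Tendsto (fun n => t (σ n)) atTop (𝓝[<] T) := by
    have h1 : Tendsto (fun n => t (σ n)) atTop (𝓝 T) := hdata.2.1.comp hσ.tendsto_atTop
    exact tendsto_nhdsWithin_iff.2 ⟨h1, Eventually.of_forall fun n => (hdata.1 (σ n)).2⟩
  -- eventual linear growth of the members
  have hgrV : ∀ᶠ n in atTop, ∀ (x : E3) (R : ℝ), 0 < R → ∫ z in Metric.ball x R, ‖V n z‖ ^ 2 ≤ A * R := by
    filter_upwards [htT.eventually hA] with n hn x R hR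
    have h := FilamentSelection.ballEnergy_zoom_le hν (hdata.2.2.2.1 (σ n)) hn 0 x hR
    simpa only [zero_add] using h
  -- bounded budgets of the members: zoom covariance + Leray's lower rate + saturation
  obtain ⟨c₀, hc₀, hler⟩ := DepletionLadder.PerFlow.lerayLowerRate_of_not_extends hν hT' hsol hLH hdec hsing
  have hZ : ∀ n, ∫ x, ‖curl (V n) x‖ ^ 2 ≤ K / (ν * (c₀ * Real.sqrt ν)) := by
    intro n
    have hMbp : 0 < Mb (σ n) := hdata.2.2.2.1 (σ n)
    have htn : t (σ n) ∈ Set.Ico 0 T := hdata.1 (σ n)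
    have hTt : 0 < T - t (σ n) := sub_pos.2 htn.2
    have hsq : 0 < Real.sqrt (T - t (σ n)) := Real.sqrt_pos.2 hTt
    have hsν : 0 < Real.sqrt ν := Real.sqrt_pos.2 hν
    set Z : ℝ := ∫ x, ‖curl (u (t (σ n))) x‖ ^ 2 with hZdef
    have hZnn : 0 ≤ Z := integral_nonneg fun _ => by positivity
    have hsat : Z * Real.sqrt (T - t (σ n)) ≤ K := hρK (σ n)
    have hKnn : 0 ≤ K := le_trans (mul_nonneg hZnn hsq.le) hsat
    obtain ⟨x₀, hx₀⟩ := hler (t (σ n)) htn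
    have hler' : c₀ * Real.sqrt ν ≤ Real.sqrt (T - t (σ n)) * Mb (σ n) :=
      hx₀.trans (mul_le_mul_of_nonneg_left (hdata.2.2.2.2.1 (σ n) x₀) hsq.le)
    have hz : ∫ x, ‖curl (V n) x‖ ^ 2 = (Mb (σ n))⁻¹ ^ 2 * (ν / Mb (σ n))⁻¹ * Z :=
      ExtremiserTransience.enstrophy_zoom (u (t (σ n))) _ (div_pos hν hMbp)
    have hz' : (Mb (σ n))⁻¹ ^ 2 * (ν / Mb (σ n))⁻¹ * Z = Z / (ν * Mb (σ n)) := by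
      field_simp
    rw [hz, hz', div_le_div_iff₀ (mul_pos hν hMbp) (mul_pos hν (mul_pos hc₀ hsν))]
    calc Z * (ν * (c₀ * Real.sqrt ν)) = ν * (Z * (c₀ * Real.sqrt ν)) := by ring
      _ ≤ ν * (Z * (Real.sqrt (T - t (σ n)) * Mb (σ n))) := by gcongr
      _ = ν * Mb (σ n) * (Z * Real.sqrt (T - t (σ n))) := by ring
      _ ≤ ν * Mb (σ n) * K := by gcongr
      _ = K * (ν * Mb (σ n)) := by ring
  have hZb : ∃ᶠ n in atTop, ∫ x, ‖curl (V n) x‖ ^ 2 ≤ K / (ν * (c₀ * Real.sqrt ν)) :=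
    (Eventually.of_forall hZ).frequently
  -- T: an extremal translate-limit; flow compactness identifies it with a slice of a Type-I ancient mild solution
  obtain ⟨y, φ, W₀, hφ, hconv, hext⟩ := hT V Λ Θ' ε' A _ hfamV hgrV hZb
  obtain ⟨ψ, K', s, W, hψ, hW, hs, hpin, hconvF⟩ := hcompF y φ hφ
  have hconv' : ∀ z : E3, Tendsto (fun n => V (φ (ψ n)) (y (φ (ψ n)) + z)) atTop (𝓝 (W s z)) := by
    intro z
    have h1 := hconvF s hs z
    simp only [sub_self, mul_zero, add_zero] at h1
    exact h1
  have hWs : W s = W₀ :=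
    funext fun z => tendsto_nhds_unique (hconv' z) ((hconv z).comp hψ.tendsto_atTop)
  subst hWs
  exact not_isExtremalSlice_of_typeIAncientMild hW hs hext

/-- Sanity: the skeleton applied to the two `sorry`-stubs elaborates and concludes the route decl. -/
example : NearExtremalTransiencePerFlow :=
  NearExtremalTransiencePerFlow_of stub_tightOfBoundedBudget stub_lerayRateOnEfficientTimes

/-- **THE WELD** (kernel-checked, no `sorry` of this file involved except through `hT`): lemma T and the ladder rung
`QuarterLawTypeI` (stmt-NavierStokesRegularity-23726) together give the crux `NearExtremalTransiencePerFlow` (stmt-26567). -/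
theorem NearExtremalTransiencePerFlow_of_quarterLawTypeI
    (hT : Registered.stub_tightOfBoundedBudget) (hQ : Theses.TypeIQuarterGate.QuarterLawTypeI) :
    NearExtremalTransiencePerFlow :=
  NearExtremalTransiencePerFlow_of hT (lerayRateOnEfficientTimes_of_quarterLawTypeI hQ)

/-! ## §5 The GAP form of T (rev 3; mined conjecture C2 of `inst/MINED_g11.md`, typed) — a purely variational sufficient condition

The instrument rows of g10/g11 (DILUTE-GAP: dilution is monotone-bad; SUPERCELL: lattice crystals beat every finite-budget configuration found by
≥ 0.016) suggest that `κ⋆` is NOT attained by finite-enstrophy fields and that, at height ≤ 1 with uniform `C^k` bounds, linear local-energy growth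
and `Z ≤ Θ·W`, an enstrophy budget `Z ≤ Zb` costs a DEFINITE efficiency deficit `δ(Λ, Θ, A, Zb) > 0`.  That statement — no limits, no centres —
implies T outright (the near-extremal bounded-budget family of T cannot exist), so a prover who believes the numerics may attack T in this form.
Its cheapest falsifier is a finite-budget extremiser (item ⟨24370⟩ `KStarAttained` answered positively IN THIS CLASS). -/

/-- **GAP form of T** (typed conjecture, NOT registered): at height ≤ 1, with uniform derivative bounds `Λ`, palinstrophy domination `Z ≤ Θ W`,
linear local-energy growth with constant `A` and enstrophy budget `Z ≤ Zb`, the depletion efficiency stays a definite `δ > 0` below `κ⋆`. -/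
def BoundedBudgetGap : Prop :=
  ∀ (Λ : ℕ → ℝ) (Θ A Zb : ℝ), ∃ δ : ℝ, 0 < δ ∧ ∀ v : E3 → E3,
    ContDiff ℝ (⊤ : ℕ∞) v → VectorCalculus.IsDivFree v → (∀ x, ‖v x‖ ≤ 1) → (∀ (k : ℕ) x, ‖iteratedFDeriv ℝ k v x‖ ≤ Λ k) →
    (∫⁻ x, ‖iteratedFDeriv ℝ 1 v x‖ₑ ^ 2 < ⊤) → (∫⁻ x, ‖iteratedFDeriv ℝ 2 v x‖ₑ ^ 2 < ⊤) →
    (∀ (x : E3) (R : ℝ), 0 < R → ∫ z in Metric.ball x R, ‖v z‖ ^ 2 ≤ A * R) →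
    (∫ x, ‖curl v x‖ ^ 2) ≤ Θ * (∫ x, frobeniusNormSq (fderiv ℝ (curl v) x)) →
    (∫ x, ‖curl v x‖ ^ 2) ≤ Zb →
    |∫ x, ⟪curl v x, fderiv ℝ v x (curl v x)⟫_ℝ| ≤
      (kStar - δ) * Real.sqrt (∫ x, ‖curl v x‖ ^ 2) * Real.sqrt (∫ x, frobeniusNormSq (fderiv ℝ (curl v) x))

/-- The GAP form implies lemma T (vacuously: under the gap, T's bounded-budget near-extremal family cannot exist). -/
theorem tightOfBoundedBudget_of_gap (hG : BoundedBudgetGap) : TightOfBoundedBudget := by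
  intro v Λ Θ ε A Zb hfam hgrow hZb
  obtain ⟨hcd, hdiv, hone, hΛ, hfin, hε, hpos, heff, hΘ⟩ := hfam
  obtain ⟨δ, hδ, hgap⟩ := hG Λ Θ A Zb
  exfalso
  have hεev : ∀ᶠ n in atTop, ε n < δ := hε.eventually (Iio_mem_nhds hδ)
  obtain ⟨n, hn, hgrow_n, hε_n⟩ := (hZb.and_eventually (hgrow.and hεev)).exists
  have hle := hgap (v n) (hcd n) (hdiv n) (hone n) (fun k x => hΛ k n x) (hfin n).1 (hfin n).2 hgrow_n (hΘ n) hn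
  have hge := heff n
  have hP := hpos n
  -- (κ⋆ − ε n)·P ≤ |J| ≤ (κ⋆ − δ)·P with P > 0 ⇒ δ ≤ ε n, contradicting ε n < δ
  have h1 : (kStar - ε n) * (Real.sqrt (∫ x, ‖curl (v n) x‖ ^ 2) * Real.sqrt (∫ x, frobeniusNormSq (fderiv ℝ (curl (v n)) x))) ≤
      (kStar - δ) * (Real.sqrt (∫ x, ‖curl (v n) x‖ ^ 2) * Real.sqrt (∫ x, frobeniusNormSq (fderiv ℝ (curl (v n)) x))) := by
    have := hge.trans hle
    simpa [mul_assoc] using this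
  have h2 : kStar - ε n ≤ kStar - δ := le_of_mul_le_mul_right h1 hP
  linarith

end Summit.NavierStokesRegularity.NavierStokesRegularity.Cruxes.NearExtremalTransiencePerFlow.LerayPincer

end
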